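import Summits.QuantumAdvantage.QuantumAdvantage.Theorems.CubicForrelationNearExactIsExactCubicFormCellL2
import Summits.QuantumAdvantage.QuantumAdvantage.Theorems.CubicForrelationNearExactIsExactCubicFormDicksonExact
import Summits.QuantumAdvantage.QuantumAdvantage.Theorems.CubicForrelationNearExactIsExactCubicFormQuadratic

/-!
# Crux `CubicForrelation.NearExactIsExact` (stmt-QuantumAdvantage-14043) — the LIGHT CELLS on `1 + 6` bits (R4 half of `E1280-even`):
  a cell with cubic form `s₀ ∧ ω_{2h}` weighs `≥ 32 − 2^{5−h}`, and if it weighs `< 32` it is EXACT with a vanishing `s₀`-half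

Certificate seat `b2b-cforr-cert` (gen 42).  HONEST FRAMING: kernel-checked assembly (standard axioms) of generic tree lemmas — the `1 + 6`
analogue of …CubicFormCellL2 `tl2_cell_eight` / `tl2_cell_eight_lb`, for the ten cells `f_v` (`v ∈ Z₁₀`) of the R4 frame once
…CubicFormR4PartnerDispatch has put their common cubic form into the normal form `t̄₇ = s₀ ∧ ω_{2h}` (`h = 1`: `T`, `h = 2`: `x₁q₄`).  It is the
Lean form of the first lines of R4-PARTNER.md §5–6 ("light ⇒ `z′ ≥ 5` exact cells" / "`z′ ≥ 9`": every cell weighs `≥ 16` resp. `≥ 24`, and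
a cell below `32` is exact) and of the exactness menus' first clause (an exact cell is `[s₀ = b]·g` with `g` quadratic).  Nothing about `θ₁₂`;
NOT summit progress.

`tl6_cell_light`: for `f : 𝔽₂^{1+6} → 𝔽₂` whose third differences are `u₀·ω(v,w) ⊕ v₀·ω(u,w) ⊕ w₀·ω(u,v)` with
`ω = Σ_{i<h} s_{lo i} ∧ s_{hi i}` (`1 ≤ h ≤ 5`, distinct coordinates): `#f + 2^{5−h} ≥ 32`, and if `#f < 32` then `#f = 32 − 2^{5−h}` and one of
the two halves `f(0,·)`, `f(1,·)` is identically zero.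
Proof: the halves `f₀, f₁` are quadratics whose forms `B₀, B₁` differ by `ω` (`tl2_cell_halves`); take maximal frames (`tcs_frame_exists`)
of sizes `r₀, r₁`.  If both are `≥ 1`, Dickson (`tce_dickson_exact`) gives `#fᵢ ≥ 16`, so `#f ≥ 32`.  If `r₀ = 0` then `B₀ ≡ 0`, `f₀` is
affine (`#f₀ ∈ {0, 32, 64}`) and `B₁ = ω` has the standard maximal frame of size `h` (`tl2_omega_frame`), so `#f₁ ∈ {32 − 2^{5−h}, 32,
32 + 2^{5−h}}`; symmetrically for `r₁ = 0`.

References: L. E. Dickson (1901); F. J. MacWilliams, N. J. A. Sloane (1977) Ch. 15 §2; this seat lineage (g41 cell lemmas).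
Axioms: the standard three.
-/

set_option linter.dupNamespace false -- D-0017: single-problem summit ⇒ `QuantumAdvantage.QuantumAdvantage` by design

namespace Summit.QuantumAdvantage.QuantumAdvantage.Theorems.CubicForrelation.NearExactIsExact

open Finset
open Literature.Computability.QuantumComplexity
open Literature.Computability.QuantumComplexity.BuzetChailloux (bxor zeroVec bxor_comm bxor_self bxor_zeroVec zeroVec_bxor
  bxor_bxor_cancel_left)

/-- **Light cells on `1 + 6` bits.**  Let `f : 𝔽₂^{1+6} → 𝔽₂` have third differences `u₀·ω(v,w) ⊕ v₀·ω(u,w) ⊕ w₀·ω(u,v)` with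
`ω(v,w) = [Σ_{i<h} v_{lo i}w_{hi i} + v_{hi i}w_{lo i} = 1]` (`1 ≤ h ≤ 5`; `lo, hi` injective with disjoint images).  Then
`32 ≤ #f + 2^{5−h}`; and if `#f < 32` then `#f + 2^{5−h} = 32` and one of the halves `s ↦ f(0,s)`, `s ↦ f(1,s)` vanishes identically.
[this work; cite: MacWilliamsSloane1977, Ch. 15 §2] -/
theorem tl6_cell_light (f : (Fin (1 + 6) → Bool) → Bool) (h : ℕ) (hh1 : 1 ≤ h) (hh5 : h ≤ 5) (lo hi : Fin h → Fin 6)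
    (hlo : Function.Injective lo) (hhi : Function.Injective hi) (hlohi : ∀ i j, lo i ≠ hi j)
    (ω' : (Fin 6 → Bool) → (Fin 6 → Bool) → Bool)
    (hω' : ∀ v w, ω' v w = decide ((∑ i : Fin h, ((if v (lo i) = true then (1 : ZMod 2) else 0) * (if w (hi i) = true then (1 : ZMod 2) else 0) +
        (if v (hi i) = true then (1 : ZMod 2) else 0) * (if w (lo i) = true then (1 : ZMod 2) else 0))) = 1))
    (hT : ∀ u v w x : Fin (1 + 6) → Bool,
      (((f x ^^ f (bxor x w)) ^^ (f (bxor x v) ^^ f (bxor (bxor x v) w))) ^^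
          ((f (bxor x u) ^^ f (bxor (bxor x u) w)) ^^ (f (bxor (bxor x u) v) ^^ f (bxor (bxor (bxor x u) v) w)))) =
        (((u (Fin.castAdd 6 (0 : Fin 1)) && ω' (fun j => v (Fin.natAdd 1 j)) (fun j => w (Fin.natAdd 1 j))) ^^
            (v (Fin.castAdd 6 (0 : Fin 1)) && ω' (fun j => u (Fin.natAdd 1 j)) (fun j => w (Fin.natAdd 1 j)))) ^^
          (w (Fin.castAdd 6 (0 : Fin 1)) && ω' (fun j => u (Fin.natAdd 1 j)) (fun j => v (Fin.natAdd 1 j))))) :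
    let f₀ : (Fin 6 → Bool) → Bool := fun s => f (Fin.append ![false] s)
    let f₁ : (Fin 6 → Bool) → Bool := fun s => f (Fin.append ![true] s)
    32 ≤ #(univ.filter fun y : Fin (1 + 6) → Bool => f y = true) + 2 ^ (5 - h) ∧
    (#(univ.filter fun y : Fin (1 + 6) → Bool => f y = true) < 32 →
      #(univ.filter fun y : Fin (1 + 6) → Bool => f y = true) + 2 ^ (5 - h) = 32 ∧
      ((∀ s, f₀ s = false) ∨ (∀ s, f₁ s = false))) := by
  intro f₀ f₁
  obtain ⟨h3, hforms⟩ := tl2_cell_halves f ω' hT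
  have h30 := h3 false
  have h31 := h3 true
  simp only at h30 h31
  -- the base-point free forms of the two halves
  obtain ⟨B₀, hB₀⟩ : ∃ B₀ : (Fin 6 → Bool) → (Fin 6 → Bool) → Bool,
      ∀ v w, B₀ v w = ((f₀ zeroVec ^^ f₀ (bxor zeroVec w)) ^^ (f₀ (bxor zeroVec v) ^^ f₀ (bxor (bxor zeroVec v) w))) :=
    ⟨_, fun v w => rfl⟩
  obtain ⟨B₁, hB₁⟩ : ∃ B₁ : (Fin 6 → Bool) → (Fin 6 → Bool) → Bool,
      ∀ v w, B₁ v w = ((f₁ zeroVec ^^ f₁ (bxor zeroVec w)) ^^ (f₁ (bxor zeroVec v) ^^ f₁ (bxor (bxor zeroVec v) w))) :=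
    ⟨_, fun v w => rfl⟩
  have hB₀' : ∀ v w x, ((f₀ x ^^ f₀ (bxor x w)) ^^ (f₀ (bxor x v) ^^ f₀ (bxor (bxor x v) w))) = B₀ v w :=
    fun v w x => by rw [hB₀]; exact tl2_second_const f₀ h30 v w x
  have hB₁' : ∀ v w x, ((f₁ x ^^ f₁ (bxor x w)) ^^ (f₁ (bxor x v) ^^ f₁ (bxor (bxor x v) w))) = B₁ v w :=
    fun v w x => by rw [hB₁]; exact tl2_second_const f₁ h31 v w x
  have hω : ∀ v w, (B₀ v w ^^ B₁ v w) = ω' v w := fun v w => by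
    rw [← hB₀' v w zeroVec, ← hB₁' v w zeroVec]; exact hforms v w zeroVec zeroVec
  have hs₀ : ∀ x y, B₀ x y = B₀ y x := fun x y => by rw [hB₀, hB₀]; exact tcq_form_symm f₀ x y
  have ha₀ : ∀ x, B₀ x x = false := fun x => by rw [hB₀]; exact tcq_form_alt f₀ x
  have hs₁ : ∀ x y, B₁ x y = B₁ y x := fun x y => by rw [hB₁, hB₁]; exact tcq_form_symm f₁ x y
  have ha₁ : ∀ x, B₁ x x = false := fun x => by rw [hB₁]; exact tcq_form_alt f₁ x
  -- counting
  have hcard : #(univ.filter fun y : Fin (1 + 6) → Bool => f y = true) =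
      #(univ.filter fun x : Fin 6 → Bool => f₀ x = true) + #(univ.filter fun x : Fin 6 → Bool => f₁ x = true) := tco_card_halves f
  have hpos5 : 0 < 2 ^ (5 - h) := Nat.two_pow_pos _
  have hpow : 2 ^ (6 - h) = 2 * 2 ^ (5 - h) := by
    have e : 6 - h = (5 - h) + 1 := by omega
    rw [e, pow_succ]; ring
  -- the standard frame of `ω'`
  obtain ⟨o1, o2, o3, o4, omax⟩ := tl2_omega_frame h lo hi hlo hhi hlohi ω' hω'
  -- maximal frames of the halves
  obtain ⟨r₀, b₀, c₀, f01, f02, f03, -, fmax0⟩ := tcs_frame_exists B₀ hs₀ ha₀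
  obtain ⟨r₁, b₁, c₁, f11, f12, f13, -, fmax1⟩ := tcs_frame_exists B₁ hs₁ ha₁
  obtain ⟨hr0n, hD₀⟩ := tce_dickson_exact f₀ B₀ hB₀' r₀ b₀ c₀ f01 f02 f03 fmax0
  obtain ⟨hr1n, hD₁⟩ := tce_dickson_exact f₁ B₁ hB₁' r₁ b₁ c₁ f11 f12 f13 fmax1
  -- empty cells from zero counts
  have hzero₀ : #(univ.filter fun x : Fin 6 → Bool => f₀ x = true) = 0 → ∀ s, f₀ s = false := by
    intro hz s
    cases hs : f₀ s
    · rfl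
    · exfalso
      have hmem : s ∈ (univ.filter fun x : Fin 6 → Bool => f₀ x = true) := mem_filter.mpr ⟨mem_univ _, hs⟩
      rw [Finset.card_eq_zero.mp hz] at hmem
      exact Finset.notMem_empty s hmem
  have hzero₁ : #(univ.filter fun x : Fin 6 → Bool => f₁ x = true) = 0 → ∀ s, f₁ s = false := by
    intro hz s
    cases hs : f₁ s
    · rfl
    · exfalso
      have hmem : s ∈ (univ.filter fun x : Fin 6 → Bool => f₁ x = true) := mem_filter.mpr ⟨mem_univ _, hs⟩
      rw [Finset.card_eq_zero.mp hz] at hmem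
      exact Finset.notMem_empty s hmem
  rcases Nat.eq_zero_or_pos r₀ with hr0 | hr0
  · -- `B₀ ≡ 0`: `f₀` affine, `B₁ = ω'`
    subst hr0
    have hB₀z : ∀ x y, B₀ x y = false := fun x y =>
      fmax0 x y (fun i => i.elim0) (fun i => i.elim0) (fun i => i.elim0) (fun i => i.elim0)
    have hB₁ω : ∀ v w, B₁ v w = ω' v w := fun v w => by rw [← hω v w, hB₀z, Bool.false_xor]
    obtain ⟨-, hE₁⟩ := tce_dickson_exact f₁ B₁ hB₁' h (fun i => fun l => decide (l = lo i)) (fun i => fun l => decide (l = hi i))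
      (fun i => by rw [hB₁ω]; exact o1 i) (fun i j hij => by rw [hB₁ω]; exact o2 i j hij) (fun i j => by rw [hB₁ω]; exact o3 i j)
      (fun x y e1 e2 e3 e4 => by
        rw [hB₁ω]
        exact omax x y (fun i => by rw [← hB₁ω]; exact e1 i) (fun i => by rw [← hB₁ω]; exact e2 i)
          (fun i => by rw [← hB₁ω]; exact e3 i) (fun i => by rw [← hB₁ω]; exact e4 i))
    rw [hpow] at hE₁
    norm_num only at hD₀ hE₁
    refine ⟨by rw [hcard]; omega, fun hlt => ?_⟩
    rw [hcard] at hlt ⊢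
    exact ⟨by omega, Or.inl (hzero₀ (by omega))⟩
  rcases Nat.eq_zero_or_pos r₁ with hr1 | hr1
  · -- `B₁ ≡ 0`: `f₁` affine, `B₀ = ω'`
    subst hr1
    have hB₁z : ∀ x y, B₁ x y = false := fun x y =>
      fmax1 x y (fun i => i.elim0) (fun i => i.elim0) (fun i => i.elim0) (fun i => i.elim0)
    have hB₀ω : ∀ v w, B₀ v w = ω' v w := fun v w => by rw [← hω v w, hB₁z, Bool.xor_false]
    obtain ⟨-, hE₀⟩ := tce_dickson_exact f₀ B₀ hB₀' h (fun i => fun l => decide (l = lo i)) (fun i => fun l => decide (l = hi i))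
      (fun i => by rw [hB₀ω]; exact o1 i) (fun i j hij => by rw [hB₀ω]; exact o2 i j hij) (fun i j => by rw [hB₀ω]; exact o3 i j)
      (fun x y e1 e2 e3 e4 => by
        rw [hB₀ω]
        exact omax x y (fun i => by rw [← hB₀ω]; exact e1 i) (fun i => by rw [← hB₀ω]; exact e2 i)
          (fun i => by rw [← hB₀ω]; exact e3 i) (fun i => by rw [← hB₀ω]; exact e4 i))
    rw [hpow] at hE₀
    norm_num only at hD₁ hE₀
    refine ⟨by rw [hcard]; omega, fun hlt => ?_⟩
    rw [hcard] at hlt ⊢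
    exact ⟨by omega, Or.inr (hzero₁ (by omega))⟩
  -- both halves have rank `≥ 2`: each weighs `≥ 16`
  have hle₀ : 2 ^ (6 - r₀) ≤ 32 :=
    calc 2 ^ (6 - r₀) ≤ 2 ^ 5 := Nat.pow_le_pow_right (by norm_num) (by omega)
      _ = 32 := by norm_num
  have hle₁ : 2 ^ (6 - r₁) ≤ 32 :=
    calc 2 ^ (6 - r₁) ≤ 2 ^ 5 := Nat.pow_le_pow_right (by norm_num) (by omega)
      _ = 32 := by norm_num
  have h64 : (2 : ℕ) ^ 6 = 64 := by norm_num
  rw [h64] at hD₀ hD₁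
  generalize hX₀ : 2 ^ (6 - r₀) = X₀ at hD₀ hle₀
  generalize hX₁ : 2 ^ (6 - r₁) = X₁ at hD₁ hle₁
  have h16₀ : 16 ≤ #(univ.filter fun x : Fin 6 → Bool => f₀ x = true) := by
    rcases hD₀ with e | e | e <;> omega
  have h16₁ : 16 ≤ #(univ.filter fun x : Fin 6 → Bool => f₁ x = true) := by
    rcases hD₁ with e | e | e <;> omega
  refine ⟨by rw [hcard]; omega, fun hlt => ?_⟩
  rw [hcard] at hlt
  omega

end Summit.QuantumAdvantage.QuantumAdvantage.Theorems.CubicForrelation.NearExactIsExact
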